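import Mathlib
import HarnessLib
import Literature.Probability.LatticeModels.TorusFourierDecayFromDifferences
import Summits.HubbardSuperconductivity.HubbardSuperconductivity.Theorems.KLProgrammeKLRegimeSplitSymInterp

/-!
# Route `KLProgramme`, crux K3 (stmt-HubbardSuperconductivity-19937) — the `symInterp` TOOLKIT, part 2: position-space decay of the
# cosine coefficients from momentum-space DIFFERENCES, differences from DERIVATIVES, the Lipschitz bound of a frame in the momentum,
# and the OFF-LATTICE interpolation error

Cell gate-hubbard-kl, seat p1b (g4).  Part 1 (`…SplitSymInterp`): exactness at lattice momenta (`symInterp_eval_latticeMomentum`) and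
`coeffNorm r (symInterp L f) ≤ Σ_x (1+|x̃₀|+|x̃₁|)^r |f_c(x)|`.  This part closes the loop used by child 2's one-volume construction
(`CtOneVolume`: the fixed point's local part is an off-lattice interpolation error) and by the engine's reading lemmas:

* §1 **decay from differences** (`abs_torusCosCoeff_mul_pow_le`): `|f_c(x)|·(4|x̃ᵢ|/L)^N ≤ L⁻² Σ_k |(Δ_{eᵢ}^N f)(k)|` — the tree's
  discrete integration by parts `norm_sum_torusChar_smul_mul_pow_le` (`TorusFourierDecayFromDifferences`, BGM 2006 Lemma 2.2 at finite
  `L`) read for the cosine coefficients; with a sup bound `|Δ_{eᵢ}^N f| ≤ B`: `|f_c(x)|·(4|x̃ᵢ|/L)^N ≤ B`;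
* §2 **differences from derivatives** (one real variable, derivative LADDER form — no `iteratedDeriv` bookkeeping for the user):
  if `G 0 = g`, `HasDerivAt (G j) (G (j+1) t) t` for `j < N` and `|G N| ≤ D`, then `|(Δ_h^N g)(t)| ≤ |h|^N·D`
  (`abs_fwdDiff_iter_le_of_derivLadder`); and the lattice-to-line identification
  `(Δ_{eᵢ}^N (F ∘ latticeMomentum L))(k) = (Δ_{2π/L}^N (t ↦ F(p_k + t·eᵢ)))(0)` for `2π`-periodic `F` (`fwdDiff_iter_latticeMomentum`);
* §3 **Lipschitz in the momentum**: `|K.eval p − K.eval p′| ≤ coeffNorm 1 K · (|p₀−p′₀| + |p₁−p′₁|)` (`abs_eval_sub_eval_le`);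
* §4 **nearest lattice momentum** (`exists_latticeMomentum_near`: every `p` is within `π/L` per coordinate of some `p_k` modulo `2πℤ²`) and
  **the off-lattice interpolation error**: for `D₄`-symmetric lattice data `f = F ∘ latticeMomentum L` of a `2π`-periodic `F` with
  `|F p − F p′| ≤ Λ·(|p₀−p′₀|+|p₁−p′₁|)`: `|(symInterp L f).eval p − F p| ≤ (coeffNorm 1 (symInterp L f) + Λ)·(2π/L)` at EVERY `p`
  (`abs_symInterp_eval_sub_le`).
Chaining §1 (N = 4 in each direction) + §2 + part 1's `coeffNorm_symInterp_le` bounds `coeffNorm 1 (symInterp L f)` uniformly in `L`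
by `C·(sup|F| + sup|∂₀⁴F| + sup|∂₁⁴F|)` — the consumer's arithmetic.  Proofs only; nothing is asserted about the model.
-/

noncomputable section

namespace Summit.HubbardSuperconductivity.HubbardSuperconductivity.Theorems.KLRegimeSplit

set_option linter.dupNamespace false -- summit = problem name (single-conjunct summit), D-0017

open Real Finset Literature.MathematicalPhysics.QuantumLattice Literature.Probability.LatticeModels

variable {L : ℕ} [NeZero L]

/-! ## §1 Position-space decay of the cosine coefficients from momentum-space differences -/

/-- Forward differences commute with the real-to-complex cast. -/
theorem fwdDiff_iter_ofReal {M : Type*} [AddCommMonoid M] (v : M) (f : M → ℝ) :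
    ∀ N : ℕ, (fwdDiff v)^[N] (fun k => (f k : ℂ)) = fun k => (((fwdDiff v)^[N] f k : ℝ) : ℂ)
  | 0 => rfl
  | N + 1 => by
    rw [Function.iterate_succ_apply, Function.iterate_succ_apply]
    have h : fwdDiff v (fun k => (f k : ℂ)) = fun k => ((fwdDiff v f k : ℝ) : ℂ) := by
      funext k; simp [fwdDiff]
    rw [h, fwdDiff_iter_ofReal v (fwdDiff v f) N]

/-- `|f_c(x)| ≤ L⁻² ‖Σ_k χ_k(x) • f(k)‖` (the real part is at most the norm). -/
theorem abs_torusCosCoeff_le_norm (f : TorusSite 2 L → ℝ) (x : TorusSite 2 L) :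
    |torusCosCoeff L f x| ≤ ((L : ℝ) ^ 2)⁻¹ * ‖∑ k, torusChar k x • ((f k : ℝ) : ℂ)‖ := by
  rw [torusCosCoeff_eq_re, abs_mul, abs_of_nonneg (by positivity)]
  refine mul_le_mul_of_nonneg_left ?_ (by positivity)
  have h : ∑ k, torusChar k x • ((f k : ℝ) : ℂ) = ∑ k, (f k : ℂ) * torusChar k x :=
    sum_congr rfl fun k _ => by rw [smul_eq_mul, mul_comm]
  rw [h]
  exact Complex.abs_re_le_norm _

/-- **Decay from differences**: `|f_c(x)|·(4|x̃ᵢ|/L)^N ≤ L⁻²·Σ_k |(Δ_{eᵢ}^N f)(k)|` for every coordinate `i` and order `N`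
(discrete integration by parts on the torus, the tree's `norm_sum_torusChar_smul_mul_pow_le`). -/
theorem abs_torusCosCoeff_mul_pow_le (f : TorusSite 2 L → ℝ) (x : TorusSite 2 L) (i : Fin 2) (N : ℕ) :
    |torusCosCoeff L f x| * (4 * |((x i).valMinAbs : ℝ)| / L) ^ N ≤
      ((L : ℝ) ^ 2)⁻¹ * ∑ k, |((fwdDiff (Pi.single i (1 : ZMod L)))^[N] f) k| := by
  have hx : (∑ j, (Pi.single i (1 : ZMod L) : TorusSite 2 L) j * x j) = x i := by
    simp [Pi.single_apply, Finset.sum_ite_eq']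
  have h := norm_sum_torusChar_smul_mul_pow_le (fun k => ((f k : ℝ) : ℂ)) (Pi.single i (1 : ZMod L)) x N
  rw [hx, fwdDiff_iter_ofReal] at h
  simp only [Complex.norm_real, Real.norm_eq_abs] at h
  have hpow : 0 ≤ (4 * |((x i).valMinAbs : ℝ)| / L) ^ N := by positivity
  calc |torusCosCoeff L f x| * (4 * |((x i).valMinAbs : ℝ)| / L) ^ N
      ≤ ((L : ℝ) ^ 2)⁻¹ * ‖∑ k, torusChar k x • ((f k : ℝ) : ℂ)‖ * (4 * |((x i).valMinAbs : ℝ)| / L) ^ N :=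
        mul_le_mul_of_nonneg_right (abs_torusCosCoeff_le_norm f x) hpow
    _ ≤ ((L : ℝ) ^ 2)⁻¹ * ∑ k, |((fwdDiff (Pi.single i (1 : ZMod L)))^[N] f) k| := by
        rw [mul_assoc]; exact mul_le_mul_of_nonneg_left h (by positivity)

/-- **Decay from a sup bound on the differences**: `|Δ_{eᵢ}^N f| ≤ B` everywhere ⇒ `|f_c(x)|·(4|x̃ᵢ|/L)^N ≤ B`. -/
theorem abs_torusCosCoeff_mul_pow_le_of_sup (f : TorusSite 2 L → ℝ) (x : TorusSite 2 L) (i : Fin 2) (N : ℕ) {B : ℝ}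
    (hB : ∀ k, |((fwdDiff (Pi.single i (1 : ZMod L)))^[N] f) k| ≤ B) :
    |torusCosCoeff L f x| * (4 * |((x i).valMinAbs : ℝ)| / L) ^ N ≤ B := by
  refine (abs_torusCosCoeff_mul_pow_le f x i N).trans ?_
  have hL : (0 : ℝ) < L := Nat.cast_pos.2 (Nat.pos_of_ne_zero (NeZero.ne L))
  have hcard : (Fintype.card (TorusSite 2 L) : ℝ) = (L : ℝ) ^ 2 := by
    simp [Fintype.card_pi, ZMod.card]
  calc ((L : ℝ) ^ 2)⁻¹ * ∑ k, |((fwdDiff (Pi.single i (1 : ZMod L)))^[N] f) k|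
      ≤ ((L : ℝ) ^ 2)⁻¹ * ∑ _k : TorusSite 2 L, B := mul_le_mul_of_nonneg_left (sum_le_sum fun k _ => hB k) (by positivity)
    _ = B := by rw [sum_const, card_univ, nsmul_eq_mul, hcard]; field_simp

/-! ## §2 Differences from derivatives (one variable), and the lattice-to-line identification -/

/-- **`|Δ_h^N g| ≤ |h|^N · sup|g⁽ᴺ⁾|`, derivative-LADDER form**: if `G 0 = g`, `G j` has derivative `G (j+1)` everywhere for `j < N`, and
`|G N| ≤ D` everywhere, then `|(Δ_h^N g)(t)| ≤ |h|^N·D` (iterated mean value theorem). -/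
theorem abs_fwdDiff_iter_le_of_derivLadder :
    ∀ (N : ℕ) (G : ℕ → ℝ → ℝ) (h D : ℝ), (∀ j < N, ∀ t, HasDerivAt (G j) (G (j + 1) t) t) → (∀ t, |G N t| ≤ D) →
      ∀ t, |((fwdDiff h)^[N] (G 0)) t| ≤ |h| ^ N * D
  | 0, G, h, D, _, hD, t => by simpa using hD t
  | N + 1, G, h, D, hG, hD, t => by
    -- the ladder of the first differences
    set G' : ℕ → ℝ → ℝ := fun j s => G j (s + h) - G j s with hG'
    have hG'd : ∀ j < N, ∀ s, HasDerivAt (G' j) (G' (j + 1) s) s := by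
      intro j hj s
      have h1 : HasDerivAt (fun s => G j (s + h)) (G (j + 1) (s + h)) s :=
        HasDerivAt.comp_add_const s h (hG j (Nat.lt_succ_of_lt hj) (s + h))
      exact h1.sub (hG j (Nat.lt_succ_of_lt hj) s)
    have hG'N : ∀ s, |G' N s| ≤ |h| * D := by
      intro s
      have hmvt := Convex.norm_image_sub_le_of_norm_hasDerivWithin_le (f := G N) (f' := G (N + 1)) (s := Set.univ)
        (fun u _ => (hG N (Nat.lt_succ_self N) u).hasDerivWithinAt) (fun u _ => by simpa using hD u) convex_univ
        (Set.mem_univ s) (Set.mem_univ (s + h))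
      simp only [hG', Real.norm_eq_abs, add_sub_cancel_left] at hmvt ⊢
      linarith [hmvt]
    have ih := abs_fwdDiff_iter_le_of_derivLadder N G' h (|h| * D) hG'd hG'N t
    have hstep : (fwdDiff h)^[N + 1] (G 0) = (fwdDiff h)^[N] (G' 0) := by
      rw [Function.iterate_succ_apply]
      rfl
    rw [hstep, pow_succ]
    calc |((fwdDiff h)^[N] (G' 0)) t| ≤ |h| ^ N * (|h| * D) := ih
      _ = |h| ^ N * |h| * D := by ring

/-- **`iteratedDeriv` corollary**: for `g` of class `C^N` with `|g⁽ᴺ⁾| ≤ D`, `|(Δ_h^N g)(t)| ≤ |h|^N·D`. -/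
theorem abs_fwdDiff_iter_le_of_contDiff {N : ℕ} {g : ℝ → ℝ} (hg : ContDiff ℝ N g) {D : ℝ}
    (hD : ∀ t, |iteratedDeriv N g t| ≤ D) (h t : ℝ) : |((fwdDiff h)^[N] g) t| ≤ |h| ^ N * D := by
  have h0 : iteratedDeriv 0 g = g := iteratedDeriv_zero
  rw [← h0]
  refine abs_fwdDiff_iter_le_of_derivLadder N (fun j => iteratedDeriv j g) h D (fun j hj s => ?_) hD t
  have hdiff : Differentiable ℝ (iteratedDeriv j g) :=
    hg.differentiable_iteratedDeriv j (by exact_mod_cast hj)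
  rw [iteratedDeriv_succ]
  exact (hdiff s).hasDerivAt

/-- A lattice momentum shifted by `m` steps in direction `i` is the original one plus `2πm/L·eᵢ` modulo `2πℤ` in that coordinate. -/
theorem latticeMomentum_add_single (k : TorusSite 2 L) (i : Fin 2) (m : ℕ) :
    ∃ z : ℤ, ∀ j, latticeMomentum L (k + m • Pi.single i (1 : ZMod L)) j =
      latticeMomentum L k j + (if j = i then 2 * π * m / L + z * (2 * π) else 0) := by
  have hL : (L : ℝ) ≠ 0 := Nat.cast_ne_zero.2 (NeZero.ne L)
  have hki : (k + m • (Pi.single i (1 : ZMod L) : TorusSite 2 L) : TorusSite 2 L) i = k i + (m : ZMod L) := by simp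
  have hkj : ∀ j, j ≠ i → (k + m • (Pi.single i (1 : ZMod L) : TorusSite 2 L) : TorusSite 2 L) j = k j :=
    fun j hj => by simp [Pi.single_eq_of_ne hj]
  have hcast : ((((k i + (m : ZMod L)).val : ℕ) : ℤ) : ZMod L) = (((k i).val + m : ℕ) : ℤ) := by
    push_cast
    rw [ZMod.natCast_zmod_val, ZMod.natCast_zmod_val]
  obtain ⟨c, hc⟩ := (ZMod.intCast_eq_intCast_iff_dvd_sub _ _ _).mp hcast
  refine ⟨-c, fun j => ?_⟩
  by_cases hj : j = i
  · subst hj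
    simp only [latticeMomentum, if_true]
    rw [hki]
    have hv : (((k j + (m : ZMod L)).val : ℕ) : ℝ) = ((k j).val : ℝ) + m - L * c := by
      have := congrArg (fun t : ℤ => (t : ℝ)) hc
      push_cast at this ⊢
      linarith
    rw [hv]; push_cast; field_simp; ring
  · simp only [latticeMomentum, if_neg hj]
    rw [hkj j hj]; ring

/-- **Lattice-to-line identification of the differences**: for `F` `2π`-periodic in every coordinate,
`(Δ_{eᵢ}^N (F ∘ latticeMomentum L))(k) = (Δ_{2π/L}^N (t ↦ F(p_k + t·eᵢ)))(0)`. -/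
theorem fwdDiff_iter_latticeMomentum (F : (Fin 2 → ℝ) → ℝ) (hper : ∀ p (z : Fin 2 → ℤ), F (fun j => p j + z j * (2 * π)) = F p)
    (i : Fin 2) (N : ℕ) (k : TorusSite 2 L) :
    ((fwdDiff (Pi.single i (1 : ZMod L)))^[N] (fun q => F (latticeMomentum L q))) k =
      ((fwdDiff (2 * π / (L : ℝ)))^[N] (fun t => F (fun j => latticeMomentum L k j + (if j = i then t else 0)))) 0 := by
  rw [fwdDiff_iter_eq_sum_shift, fwdDiff_iter_eq_sum_shift]
  refine sum_congr rfl fun m _ => ?_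
  congr 1
  obtain ⟨z, hz⟩ := latticeMomentum_add_single k i m
  have harg : (fun j => latticeMomentum L k j + (if j = i then (0 : ℝ) + m • (2 * π / (L : ℝ)) else 0)) =
      fun j => latticeMomentum L (k + m • Pi.single i (1 : ZMod L)) j + (fun j => if j = i then -z else 0) j * (2 * π) := by
    funext j
    rw [hz j]
    by_cases hj : j = i
    · simp only [hj, if_true, nsmul_eq_mul]; push_cast; ring
    · simp only [if_neg hj]; push_cast; ring
  rw [zero_add, show (fun j => latticeMomentum L k j + if j = i then (m • (2 * π / (L : ℝ))) else 0) =
      (fun j => latticeMomentum L k j + (if j = i then (0 : ℝ) + m • (2 * π / (L : ℝ)) else 0)) by simp, harg, hper]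

/-! ## §3 A frame is Lipschitz in the momentum, with constant `coeffNorm 1` -/

/-- `|cos(m a) − cos(m a′)| ≤ m·|a − a′|`. -/
theorem abs_cos_nat_mul_sub_le (m : ℕ) (a a' : ℝ) : |Real.cos (m * a) - Real.cos (m * a')| ≤ m * |a - a'| := by
  refine (Real.abs_cos_sub_cos_le _ _).trans ?_
  rw [← mul_sub, abs_mul, Nat.abs_cast]

/-- The harmonics are Lipschitz: `|h_{m,n}(p) − h_{m,n}(p′)| ≤ (1 + m + n)·(|p₀ − p′₀| + |p₁ − p′₁|)`. -/
theorem abs_harmonic_sub_le (m n : ℕ) (p p' : Fin 2 → ℝ) :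
    |TrigPolyC4v.harmonic m n p - TrigPolyC4v.harmonic m n p'| ≤ (1 + m + n : ℝ) * (|p 0 - p' 0| + |p 1 - p' 1|) := by
  have hprod : ∀ (a b : ℕ) (s t s' t' : ℝ), |Real.cos (a * s) * Real.cos (b * t) - Real.cos (a * s') * Real.cos (b * t')| ≤
      a * |s - s'| + b * |t - t'| := by
    intro a b s t s' t'
    have e : Real.cos (a * s) * Real.cos (b * t) - Real.cos (a * s') * Real.cos (b * t') =
        (Real.cos (a * s) - Real.cos (a * s')) * Real.cos (b * t) + Real.cos (a * s') * (Real.cos (b * t) - Real.cos (b * t')) := by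
      ring
    rw [e]
    refine (abs_add_le _ _).trans (add_le_add ?_ ?_)
    · rw [abs_mul]
      exact (mul_le_of_le_one_right (abs_nonneg _) (Real.abs_cos_le_one _)).trans (abs_cos_nat_mul_sub_le a s s')
    · rw [abs_mul]
      exact (mul_le_of_le_one_left (abs_nonneg _) (Real.abs_cos_le_one _)).trans (abs_cos_nat_mul_sub_le b t t')
  unfold TrigPolyC4v.harmonic
  rw [← sub_div, abs_div, abs_two]
  have h1 := hprod m n (p 0) (p 1) (p' 0) (p' 1)
  have h2 := hprod n m (p 0) (p 1) (p' 0) (p' 1)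
  have e : Real.cos (m * p 0) * Real.cos (n * p 1) + Real.cos (n * p 0) * Real.cos (m * p 1) -
      (Real.cos (m * p' 0) * Real.cos (n * p' 1) + Real.cos (n * p' 0) * Real.cos (m * p' 1)) =
      (Real.cos (m * p 0) * Real.cos (n * p 1) - Real.cos (m * p' 0) * Real.cos (n * p' 1)) +
        (Real.cos (n * p 0) * Real.cos (m * p 1) - Real.cos (n * p' 0) * Real.cos (m * p' 1)) := by ring
  rw [e]
  have h3 := (abs_add_le _ _).trans (add_le_add h1 h2)
  have h0 : 0 ≤ |p 0 - p' 0| := abs_nonneg _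
  have h1' : 0 ≤ |p 1 - p' 1| := abs_nonneg _
  rw [div_le_iff₀ (by norm_num : (0 : ℝ) < 2)]
  nlinarith [h3, h0, h1', Nat.cast_nonneg (α := ℝ) m, Nat.cast_nonneg (α := ℝ) n]

/-- **A frame is Lipschitz in the momentum**: `|K(p) − K(p′)| ≤ coeffNorm 1 K · (|p₀ − p′₀| + |p₁ − p′₁|)`. -/
theorem abs_eval_sub_eval_le (K : TrigPolyC4v) (p p' : Fin 2 → ℝ) :
    |K.eval p - K.eval p'| ≤ K.coeffNorm 1 * (|p 0 - p' 0| + |p 1 - p' 1|) := by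
  rw [TrigPolyC4v.eval_def, TrigPolyC4v.eval_def, TrigPolyC4v.coeffNorm, ← sum_sub_distrib, sum_mul]
  refine (abs_sum_le_sum_abs _ _).trans (sum_le_sum fun m _ => ?_)
  rw [← sum_sub_distrib, sum_mul]
  refine (abs_sum_le_sum_abs _ _).trans (sum_le_sum fun n _ => ?_)
  rw [← mul_sub, abs_mul, pow_one, mul_comm ((1 + m + n : ℝ)) |K.coeff m n|, mul_assoc]
  exact mul_le_mul_of_nonneg_left (abs_harmonic_sub_le m n p p') (abs_nonneg _)

/-! ## §4 Nearest lattice momentum and the off-lattice interpolation error -/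

/-- **Every momentum is within `π/L` per coordinate of a lattice momentum, modulo `2πℤ²`.** -/
theorem exists_latticeMomentum_near (p : Fin 2 → ℝ) :
    ∃ (k : TorusSite 2 L) (z : Fin 2 → ℤ), ∀ j, |p j - (latticeMomentum L k j + z j * (2 * π))| ≤ π / L := by
  have hL : (0 : ℝ) < L := Nat.cast_pos.2 (Nat.pos_of_ne_zero (NeZero.ne L))
  have hLne : (L : ℝ) ≠ 0 := hL.ne'
  -- round each coordinate to the grid `2πℤ/L`
  set m : Fin 2 → ℤ := fun j => round (p j * L / (2 * π)) with hm
  refine ⟨fun j => (m j : ZMod L), fun j => m j / (L : ℤ), fun j => ?_⟩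
  have hval : ((((m j : ℤ) : ZMod L).val : ℕ) : ℤ) = m j % (L : ℤ) := ZMod.val_intCast (m j)
  have hdecomp : (((((m j : ℤ) : ZMod L).val : ℕ) : ℝ)) = (m j : ℝ) - (L : ℝ) * ((m j / (L : ℤ) : ℤ) : ℝ) := by
    have h1 : ((m j % (L : ℤ) : ℤ) : ℝ) = (m j : ℝ) - (L : ℝ) * ((m j / (L : ℤ) : ℤ) : ℝ) := by
      have := Int.emod_def (m j) (L : ℤ)
      rw [this]; push_cast; ring
    rw [← h1]
    exact_mod_cast congrArg (fun t : ℤ => (t : ℝ)) hval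
  simp only [latticeMomentum]
  rw [hdecomp]
  have hround : |p j * L / (2 * π) - m j| ≤ 1 / 2 := by rw [hm]; exact abs_sub_round _
  have hpi : 0 < π := Real.pi_pos
  have e : p j - (2 * π * ((m j : ℝ) - L * ((m j / (L : ℤ) : ℤ) : ℝ)) / L + ((m j / (L : ℤ) : ℤ) : ℝ) * (2 * π)) =
      (2 * π / L) * (p j * L / (2 * π) - m j) := by
    field_simp
    ring
  rw [e, abs_mul, abs_of_pos (by positivity)]
  calc 2 * π / L * |p j * L / (2 * π) - m j| ≤ 2 * π / L * (1 / 2) := mul_le_mul_of_nonneg_left hround (by positivity)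
    _ = π / L := by ring

/-- **THE OFF-LATTICE INTERPOLATION ERROR.**  Let `F` be `2π`-periodic in both coordinates and Lipschitz,
`|F p − F p′| ≤ Λ·(|p₀−p′₀| + |p₁−p′₁|)` (`Λ ≥ 0`), and let its lattice samples `f = F ∘ latticeMomentum L` be `D₄`-symmetric (even, reflection- and
swap-invariant).  Then at EVERY momentum `p`:
`|(symInterp L f).eval p − F p| ≤ (coeffNorm 1 (symInterp L f) + Λ) · (2π/L)`. -/
theorem abs_symInterp_eval_sub_le (F : (Fin 2 → ℝ) → ℝ) (hper : ∀ p (z : Fin 2 → ℤ), F (fun j => p j + z j * (2 * π)) = F p)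
    {Λ : ℝ} (hΛ : 0 ≤ Λ) (hLip : ∀ p p' : Fin 2 → ℝ, |F p - F p'| ≤ Λ * (|p 0 - p' 0| + |p 1 - p' 1|))
    (heven : ∀ k : TorusSite 2 L, F (latticeMomentum L (-k)) = F (latticeMomentum L k))
    (hrefl : ∀ k : TorusSite 2 L, F (latticeMomentum L ![k 0, -k 1]) = F (latticeMomentum L k))
    (hswap : ∀ k : TorusSite 2 L, F (latticeMomentum L ![k 1, k 0]) = F (latticeMomentum L k)) (p : Fin 2 → ℝ) :
    |(symInterp L (fun k => F (latticeMomentum L k))).eval p - F p| ≤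
      ((symInterp L (fun k => F (latticeMomentum L k))).coeffNorm 1 + Λ) * (2 * π / L) := by
  have hL : (0 : ℝ) < L := Nat.cast_pos.2 (Nat.pos_of_ne_zero (NeZero.ne L))
  set I := symInterp L (fun k => F (latticeMomentum L k)) with hI
  obtain ⟨k, z, hk⟩ := exists_latticeMomentum_near (L := L) p
  -- move `p` by the period `−2πz` next to the lattice momentum
  set p' : Fin 2 → ℝ := fun j => p j + (-z j : ℤ) * (2 * π) with hp'
  have hIp : I.eval p' = I.eval p := by rw [hp']; exact TrigPolyC4v.eval_periodic I p fun j => -z j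
  have hFp : F p' = F p := by rw [hp']; exact hper p fun j => -z j
  have hdist : |p' 0 - latticeMomentum L k 0| + |p' 1 - latticeMomentum L k 1| ≤ 2 * π / L := by
    have h0 := hk 0
    have h1 := hk 1
    have e0 : p' 0 - latticeMomentum L k 0 = p 0 - (latticeMomentum L k 0 + z 0 * (2 * π)) := by
      simp only [hp']; push_cast; ring
    have e1 : p' 1 - latticeMomentum L k 1 = p 1 - (latticeMomentum L k 1 + z 1 * (2 * π)) := by
      simp only [hp']; push_cast; ring
    rw [e0, e1]
    have : π / L + π / L = 2 * π / L := by ring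
    linarith
  -- exactness at the lattice momentum
  have hexact : I.eval (latticeMomentum L k) = F (latticeMomentum L k) :=
    symInterp_eval_latticeMomentum (fun q => F (latticeMomentum L q)) heven hrefl hswap k
  rw [← hIp, ← hFp]
  have h1 : |I.eval p' - I.eval (latticeMomentum L k)| ≤ I.coeffNorm 1 * (2 * π / L) :=
    (abs_eval_sub_eval_le I p' (latticeMomentum L k)).trans
      (mul_le_mul_of_nonneg_left hdist (TrigPolyC4v.coeffNorm_nonneg 1 I))
  have h2 : |F (latticeMomentum L k) - F p'| ≤ Λ * (2 * π / L) := by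
    refine (hLip _ _).trans ?_
    rw [abs_sub_comm (latticeMomentum L k 0), abs_sub_comm (latticeMomentum L k 1)]
    exact mul_le_mul_of_nonneg_left hdist hΛ
  calc |I.eval p' - F p'| = |(I.eval p' - I.eval (latticeMomentum L k)) + (F (latticeMomentum L k) - F p')| := by
        rw [hexact]; ring_nf
    _ ≤ |I.eval p' - I.eval (latticeMomentum L k)| + |F (latticeMomentum L k) - F p'| := abs_add_le _ _
    _ ≤ I.coeffNorm 1 * (2 * π / L) + Λ * (2 * π / L) := add_le_add h1 h2
    _ = (I.coeffNorm 1 + Λ) * (2 * π / L) := by ring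

end Summit.HubbardSuperconductivity.HubbardSuperconductivity.Theorems.KLRegimeSplit

end
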